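import Summits.AtomisticToContinuum.Crystallization.Theorems.FrustratedLawDichotomyPairPotentialDoorXMoves
import Summits.AtomisticToContinuum.Crystallization.Theorems.FrustratedLawDichotomyMotifDoorE

/-!
# FrustratedLawDichotomy · crux `AperiodicFrustratedLawGap` (stmt-AtomisticToContinuum-27623) — the ELASTIC-class X-door (credits of both signs
# AND the exemption indicator) and the SPLIT node of record from TWO motif-certified rules with a motif-decided exemption column
# (decomp-a2c, prover hand 2, structural share, generation 15; generic, radius-free)

`…PairPotentialDoorX` (this generation) adds the exemption indicator to the nonpositive-credit door (T′♭ / FRG♭ side); `…MotifDoorE` (hand-2 g12) is the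
door for the ELASTIC class, whose `η₁`-good credit is POSITIVE and is over-approximated on the motif by `MaybeGoodAt`.  This file merges them —
critic row 543 (B1): «E′♭₄₅ AT RISK on the E-side; the force-bearing thin adversaries are EXEMPT under the exchange test at ε ≤ 10⁻³» — so that the
E-side certificate, too, may refund the ε-Nash-unstable motifs:

* §1 ★ `schurElasticPricingX_of_ruleX` — `PairRuleCertificateX η₀ η₁ W A (eUp − D_E) (−(κ_E + C_E)) (κ_E + D_E) (−D_X) … Ex ⟹ Eopt♭_X(κ_E, C_E, D_E, D_X; Ex)`
  (`…ExemptSplit.SchurElasticPricingX`);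
* §2 `PairRuleMotifCertificateXE η₀ η₁ W A c₀ cneg cpos cex D ϱ F ExM` (level `c₀ + cneg𝟙[GoodAtScale η₀ D] + cpos𝟙[MaybeGoodAt η₁ D] + cex𝟙[ExM]`),
  `motif_transferEX`, ★★ THE DOOR `pairRuleCertificateX_of_motifXE` (`cneg ≤ 0 ≤ cpos`, `cex ≤ 0`, `η₁ ≤ 3/10`, `MotifTransfer ϱ ExM Ex`),
  `schurElasticPricingX_fourHalf_of_motifXE`;
* §3 ★★ `aperiodicFrustratedLawGap_of_schurMotifsX_fourHalf` — `MuEquilibriumDoor ∧ SF₄₅ ∧ UP(−0.7175) ∧ DeepAbsent M Ex ∧ MotifTransfer ϱ ExM Ex ∧` two rules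
  `F_T` (X-motif certificate, level `(−0.7175 + κ_T, −C_T, −κ_T, −D_T)`) and `F_E` (XE-motif certificate, level `(−0.7175 − D_E, −(κ_E + C_E), κ_E + D_E, −D_X)`)
  on radius-`ϱ` motifs `⟹` crux (via `…ExemptSplit.aperiodicFrustratedLawGap_of_splitX_fourHalf`); instances ★★ `…_of_schurMotifsX_move_fourHalf`
  (exemption column `MoveUnstableLoc ε Rm s` of `…PairPotentialDoorXMoves`, `1 + s ≤ Rm ≤ ϱ`) and `…_of_schurMotifsX_exchangeLoc_fourHalf`
  (`ExchangeUnstableLoc (ε + 2K·T♯(D)) ϱ′ Rm K`, `ϱ′ + D ≤ Rm ≤ ϱ`, `D ≥ 1`).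

All `[folklore]` bookkeeping on landed lemmas; 0 sorry.
-/

noncomputable section

namespace Summit.AtomisticToContinuum.Crystallization.Theorems.FrustratedLawDichotomyPairPotentialDoorXE

open scoped BigOperators Classical
open Metric
open Literature.MathematicalPhysics.StatisticalMechanics (interactionEnergy lennardJones)
open Summit.AtomisticToContinuum.Crystallization.Theorems.ChargedEnergyGapNegative (E3 eStar)
open Summit.AtomisticToContinuum.Crystallization.Theorems.FrustratedLawDichotomyRangeCut
open Summit.AtomisticToContinuum.Crystallization.Theorems.FrustratedLawDichotomyLocalPricing (goodCount_eq_sum)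
open Summit.AtomisticToContinuum.Crystallization.Theorems.FrustratedLawDichotomyLocalDischargingRule
open Summit.AtomisticToContinuum.Crystallization.Theorems.FrustratedLawDichotomyMotifLemmas
open Summit.AtomisticToContinuum.Crystallization.Theorems.FrustratedLawDichotomySchurCut
open Summit.AtomisticToContinuum.Crystallization.Theorems.FrustratedLawDichotomyPairPotentialDoor
open Summit.AtomisticToContinuum.Crystallization.Theorems.FrustratedLawDichotomyMotifDoorE (MaybeGoodAt maybeGood_of_goodAt)
open Summit.AtomisticToContinuum.Crystallization.Theorems.FrustratedLawDichotomyPairPotentialDoorX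
open Summit.AtomisticToContinuum.Crystallization.Theorems.FrustratedLawDichotomyPairPotentialDoorXMoves
open Summit.AtomisticToContinuum.Crystallization.Theorems.FrustratedLawDichotomyExemptDoor (SitePred DeepAbsent)
open Summit.AtomisticToContinuum.Crystallization.Theorems.FrustratedLawDichotomyExemptRemoval (tailConst)
open Summit.AtomisticToContinuum.Crystallization.Theorems.FrustratedLawDichotomyExemptLocOpt (ExchangeUnstable deepAbsent_exchangeUnstable)
open Summit.AtomisticToContinuum.Crystallization.Theorems.FrustratedLawDichotomyExemptSplit
  (SchurTopologicalPricingX SchurElasticPricingX aperiodicFrustratedLawGap_of_splitX_fourHalf)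
open Summit.AtomisticToContinuum.Crystallization.Theorems.FrustratedLawDichotomyExemptLocal (ExchangeUnstableLoc)
open Summit.AtomisticToContinuum.Crystallization.Theorems.FrustratedLawDichotomyExemptLocalSharp (tailConstSharp)

/-! ## §1. The elastic residual with exemptions from an X-rule certificate -/

/-- ★ **`Eopt♭_X ⟸ X-rule certificate`** with `W = effPot w ω A`, `c = (eUp − D_E, −(κ_E + C_E), κ_E + D_E, −D_X)`. [folklore] -/
theorem schurElasticPricingX_of_ruleX {η₀ η₁ : ℝ} {w ω : ℝ → ℝ} {A eUp κE CE DE DX R' ρ B : ℝ} {F : TransferRule} {Ex : SitePred}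
    (h : PairRuleCertificateX η₀ η₁ (effPot w ω A) A (eUp - DE) (-(κE + CE)) (κE + DE) (-DX) R' ρ B F Ex) :
    SchurElasticPricingX η₀ η₁ w ω A eUp κE CE DE DX Ex := by
  intro N y hy hsep
  have := sum_le_of_pairRuleCertificateX h N y hy hsep
  linarith

/-! ## §2. The elastic-class motif certificate with exemptions and its door -/

/-- **`PairRuleMotifCertificateXE η₀ η₁ W A c₀ cneg cpos cex D ϱ F ExM`** — per-motif inequality of the elastic class with the motif-level exemption:
for every injective `7/10`-separated motif `z` confined to radius `ϱ` about the centre `c`,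
`c₀ + cneg·𝟙[GoodAtScale η₀ D z c] + cpos·𝟙[MaybeGoodAt η₁ D z c] + cex·𝟙[ExM M z c] ≤ (Σ_a W(dist (z c) (z a)) − W 0)/2 − A + netInflow F M z c`. -/
def PairRuleMotifCertificateXE (η₀ η₁ : ℝ) (W : ℝ → ℝ) (A c₀ cneg cpos cex D ϱ : ℝ) (F : TransferRule) (ExM : SitePred) : Prop :=
  ∀ (M : ℕ) (z : Fin M → E3), Function.Injective z → Sep z → ∀ c : Fin M, (∀ a : Fin M, dist (z a) (z c) ≤ ϱ) →
    c₀ + cneg * (if GoodAtScale η₀ D z c then (1 : ℝ) else 0) + cpos * (if MaybeGoodAt η₁ D z c then (1 : ℝ) else 0) +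
        cex * (if ExM M z c then (1 : ℝ) else 0) ≤
      (∑ a, W (dist (z c) (z a)) - W 0) / 2 - A + netInflow F M z c

/-- An elastic-class motif certificate WITHOUT exemptions is an XE-certificate for any `ExM` when `cex ≤ 0`. [folklore] -/
theorem pairRuleMotifCertificateXE_of_certE {η₀ η₁ : ℝ} {W : ℝ → ℝ} {A c₀ cneg cpos cex D ϱ : ℝ} {F : TransferRule} (ExM : SitePred)
    (hcex : cex ≤ 0) (h : FrustratedLawDichotomyMotifDoorE.PairRuleMotifCertificateE η₀ η₁ W A c₀ cneg cpos D ϱ F) :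
    PairRuleMotifCertificateXE η₀ η₁ W A c₀ cneg cpos cex D ϱ F ExM := by
  intro M z hz hsep c hconf
  have hm := h M z hz hsep c hconf
  have h0 : cex * (if ExM M z c then (1 : ℝ) else 0) ≤ 0 := mul_nonpos_of_nonpos_of_nonneg hcex (by split_ifs <;> norm_num)
  linarith

/-- **THE MOTIF LEMMA, elastic class with exemptions** (both directions of goodness transfer and `MotifTransfer ϱ ExM Ex`). [folklore] -/
theorem motif_transferEX {W : ℝ → ℝ} {R R' ρ ϱ A D : ℝ} {F : TransferRule} {ExM Ex : SitePred} (hW : ∀ r, R ≤ r → W r = 0)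
    (hF₁ : HasRange R' F) (hF₂ : IsLocal ρ F)
    (h0 : 0 ≤ ϱ) (hR : R ≤ ϱ) (hRρ : R' + ρ ≤ ϱ) (hρ : ρ ≤ ϱ) (hR' : R' ≤ ϱ) (hD : 13 / 10 * D + 1 ≤ ϱ) (hEx : MotifTransfer ϱ ExM Ex)
    {N : ℕ} {y : Fin N → E3} (hy : Function.Injective y) (hsep : Sep y) (i : Fin N) :
    ∃ (M : ℕ) (z : Fin M → E3) (c : Fin M), Function.Injective z ∧ Sep z ∧ (∀ a : Fin M, dist (z a) (z c) ≤ ϱ) ∧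
      (∑ a, W (dist (z c) (z a)) - W 0) / 2 - A + netInflow F M z c =
        (∑ j, W (dist (y i) (y j)) - W 0) / 2 - A + netInflow F N y i ∧
      (∀ η : ℝ, GoodAtScale η D z c → GoodAt η y i) ∧
      (∀ η : ℝ, η ≤ 3 / 10 → GoodAt η y i → MaybeGoodAt η D z c) ∧ (ExM M z c → Ex N y i) := by
  set S : Finset (Fin N) := Finset.univ.filter (fun j => dist (y j) (y i) ≤ ϱ) with hS
  have hSdef0 : ∀ j, j ∈ S ↔ dist (y j) (y i) ≤ ϱ := fun j => by simp [hS]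
  have hiS : i ∈ S := (hSdef0 i).2 (by rw [dist_self]; exact h0)
  let φ : Fin S.card ↪o Fin N := S.orderEmbOfFin rfl
  have hφ : Set.range φ = ↑S := Finset.range_orderEmbOfFin S rfl
  have hiφ : i ∈ Set.range φ := by rw [hφ]; exact hiS
  obtain ⟨c, hc⟩ := hiφ
  have hSdef : ∀ j, j ∈ S ↔ dist (y j) (y (φ c)) ≤ ϱ := by rw [hc]; exact hSdef0
  have hSr : ∀ k : Fin N, dist (y k) (y (φ c)) ≤ ϱ → k ∈ Set.range φ := fun k hk => by
    rw [hφ]; exact (hSdef k).2 hk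
  have hφinj : Function.Injective φ := φ.injective
  refine ⟨S.card, y ∘ φ, c, hy.comp hφinj, fun a b hab => hsep (φ a) (φ b) (hφinj.ne hab), fun a => ?_, ?_, fun η hη => ?_,
    fun η hη3 hη => ?_, fun hM => ?_⟩
  · have ha : φ a ∈ S := by
      have h : φ a ∈ Set.range φ := ⟨a, rfl⟩
      rw [hφ] at h
      exact h
    exact (hSdef (φ a)).1 ha
  · have e1 : ∑ a, W (dist ((y ∘ φ) c) ((y ∘ φ) a)) = ∑ j, W (dist (y (φ c)) (y j)) := pairSum_motif hW hR φ hφ hSdef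
    have e3 : netInflow F S.card (y ∘ φ) c = netInflow F N y (φ c) := netInflow_motif hF₁ hF₂ hRρ hρ hR' φ hφ hSdef
    rw [e1, e3, hc]
  · rw [← hc]; exact goodAt_of_motif hSr hD hη
  · rw [← hc] at hη; exact maybeGood_of_goodAt hy hφinj hSr hD hη3 hη
  · rw [← hc]; exact hEx N S.card y φ c hy hsep hφinj hSr hM

/-- ★★ **THE DOOR, elastic class with exemptions**: `W` vanishing from `R` on, rule of range `R′`, locality `ρ`, bound `B`, motif radius
`ϱ ≥ max (R, R′ + ρ, ρ, R′, 13/10·D + 1, 0)`, `cneg ≤ 0 ≤ cpos`, `cex ≤ 0`, `η₁ ≤ 3/10`, `MotifTransfer ϱ ExM Ex`: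
`PairRuleMotifCertificateXE η₀ η₁ W A c₀ cneg cpos cex D ϱ F ExM ⟹ PairRuleCertificateX η₀ η₁ W A c₀ cneg cpos cex R′ ρ B F Ex`. [folklore] -/
theorem pairRuleCertificateX_of_motifXE {η₀ η₁ : ℝ} {W : ℝ → ℝ} {R A c₀ cneg cpos cex D ϱ R' ρ B : ℝ} {F : TransferRule} {ExM Ex : SitePred}
    (hW : ∀ r, R ≤ r → W r = 0) (hF₁ : HasRange R' F) (hF₂ : IsLocal ρ F) (hF₃ : IsBounded B F)
    (h0 : 0 ≤ ϱ) (hR : R ≤ ϱ) (hRρ : R' + ρ ≤ ϱ) (hρ : ρ ≤ ϱ) (hR' : R' ≤ ϱ) (hD : 13 / 10 * D + 1 ≤ ϱ)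
    (hEx : MotifTransfer ϱ ExM Ex) (hneg : cneg ≤ 0) (hpos : 0 ≤ cpos) (hcex : cex ≤ 0) (hη₁ : η₁ ≤ 3 / 10)
    (h : PairRuleMotifCertificateXE η₀ η₁ W A c₀ cneg cpos cex D ϱ F ExM) :
    PairRuleCertificateX η₀ η₁ W A c₀ cneg cpos cex R' ρ B F Ex := by
  refine ⟨hF₁, hF₂, hF₃, fun N y hy hsep i => ?_⟩
  obtain ⟨M, z, c, hz, hzsep, hconf, hrhs, hgood, hmaybe, hex⟩ :=
    motif_transferEX (A := A) hW hF₁ hF₂ h0 hR hRρ hρ hR' hD hEx hy hsep i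
  have hm := h M z hz hzsep c hconf
  rw [hrhs] at hm
  have e0 := mul_le_mul_of_nonpos_left (ite_le_ite_of_imp (hgood η₀)) hneg
  have e1 := mul_le_mul_of_nonneg_left (ite_le_ite_of_imp (hmaybe η₁ hη₁)) hpos
  have e2 := mul_le_mul_of_nonpos_left (ite_le_ite_of_imp hex) hcex
  linarith

/-- ★ **`Eopt♭_X(κ_E, C_E, D_E, D_X; Ex) ⟸ XE-motif certificate`** at `(w₄₅, ω₄, 3/400)` (`0 ≤ κ_E + C_E`, `0 ≤ κ_E + D_E`, `0 ≤ D_X`, `η₁ ≤ 3/10`,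
radius `ϱ ≥ max (9/2, R′ + ρ, ρ, R′, 13/10·D + 1)`, `MotifTransfer ϱ ExM Ex`). [folklore chaining] -/
theorem schurElasticPricingX_fourHalf_of_motifXE {η₀ η₁ eUp κE CE DE DX D ϱ R' ρ B : ℝ} {F : TransferRule} {ExM Ex : SitePred}
    (hF₁ : HasRange R' F) (hF₂ : IsLocal ρ F) (hF₃ : IsBounded B F)
    (hR : 9 / 2 ≤ ϱ) (hRρ : R' + ρ ≤ ϱ) (hρ : ρ ≤ ϱ) (hR' : R' ≤ ϱ) (hD : 13 / 10 * D + 1 ≤ ϱ)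
    (hneg : 0 ≤ κE + CE) (hpos : 0 ≤ κE + DE) (hDX : 0 ≤ DX) (hη₁ : η₁ ≤ 3 / 10) (hEx : MotifTransfer ϱ ExM Ex)
    (h : PairRuleMotifCertificateXE η₀ η₁ (effPot w₄₅ ω₄ (3 / 400)) (3 / 400) (eUp - DE) (-(κE + CE)) (κE + DE) (-DX) D ϱ F ExM) :
    SchurElasticPricingX η₀ η₁ w₄₅ ω₄ (3 / 400) eUp κE CE DE DX Ex :=
  schurElasticPricingX_of_ruleX
    (pairRuleCertificateX_of_motifXE (fun r hr => effPot_fourHalf_eq_zero _ hr) hF₁ hF₂ hF₃ (by linarith) hR hRρ hρ hR' hD hEx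
      (by linarith) hpos (by linarith) hη₁ h)

/-! ## §3. The SPLIT node of record from two motif-certified rules with a motif-decided exemption column -/

/-- ★★ **The crux from `MuEquilibriumDoor ∧ SF₄₅ ∧ UP(−0.7175)` and TWO motif-certified rules with exemptions**: `F_T` (range `R′`, locality `ρ`,
bound `B`) with an X-motif certificate at level `(−0.7175 + κ_T, −C_T, −κ_T, −D_T)` and `F_E` (range `R″`, locality `ρ′`, bound `B′`) with an
XE-motif certificate at level `(−0.7175 − D_E, −(κ_E + C_E), κ_E + D_E, −D_X)`, both at `W₄₅`, tolerances `(1/20, 1/8)`, cap `D`, radius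
`ϱ ≥ max (9/2, R′ + ρ, ρ, R′, R″ + ρ′, ρ′, R″, 13/10·D + 1)`, with a deep-absent `Ex` and `MotifTransfer ϱ ExM Ex`;
`κ_T, κ_E > 0`, `C_T, D_T, D_X ≥ 0`, `κ_E + C_E, κ_E + D_E ≥ 0`. [folklore chaining] -/
theorem aperiodicFrustratedLawGap_of_schurMotifsX_fourHalf {κT CT DT κE CE DE DX D ϱ R' ρ B R'' ρ' B' Mdepth : ℝ}
    {FT FE : TransferRule} {ExM Ex : SitePred}
    (hDoor : Summit.AtomisticToContinuum.Crystallization.Theses.GrainCoreNetworkSplit.MuEquilibriumDoor)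
    (hF : SF₄₅) (hU : PeriodicEnergyCeiling (-(7175 / 10000))) (hExDeep : DeepAbsent Mdepth Ex) (hEx : MotifTransfer ϱ ExM Ex)
    (hT₁ : HasRange R' FT) (hT₂ : IsLocal ρ FT) (hT₃ : IsBounded B FT)
    (hE₁ : HasRange R'' FE) (hE₂ : IsLocal ρ' FE) (hE₃ : IsBounded B' FE)
    (hR : 9 / 2 ≤ ϱ) (hRρ : R' + ρ ≤ ϱ) (hρ : ρ ≤ ϱ) (hR' : R' ≤ ϱ) (hRρ' : R'' + ρ' ≤ ϱ) (hρ'' : ρ' ≤ ϱ) (hR'' : R'' ≤ ϱ)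
    (hD : 13 / 10 * D + 1 ≤ ϱ)
    (hκT : 0 < κT) (hCT : 0 ≤ CT) (hDT : 0 ≤ DT) (hκE : 0 < κE) (hCE : 0 ≤ κE + CE) (hDE : 0 ≤ κE + DE) (hDX : 0 ≤ DX)
    (hT : PairRuleMotifCertificateX (1 / 20) (1 / 8) (effPot w₄₅ ω₄ (3 / 400)) (3 / 400) (-(7175 / 10000) + κT) (-CT) (-κT) (-DT)
      D ϱ FT ExM)
    (hEc : PairRuleMotifCertificateXE (1 / 20) (1 / 8) (effPot w₄₅ ω₄ (3 / 400)) (3 / 400) (-(7175 / 10000) - DE) (-(κE + CE)) (κE + DE)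
      (-DX) D ϱ FE ExM) :
    Summit.AtomisticToContinuum.Crystallization.Theses.FrustratedLawDichotomy.AperiodicFrustratedLawGap :=
  aperiodicFrustratedLawGap_of_splitX_fourHalf hDoor hF hU hExDeep hκT hDT
    (schurTopologicalPricingX_fourHalf_of_motifX hT₁ hT₂ hT₃ hR hRρ hρ hR' hD hκT.le hCT hDT hEx hT) hκE hDX
    (schurElasticPricingX_fourHalf_of_motifXE hE₁ hE₂ hE₃ hR hRρ' hρ'' hR'' hD hCE hDE hDX (by norm_num) hEx hEc)

/-- ★★ **Instance: the ONE-ATOM-MOVE exemption column** (`ExM = MoveUnstableLoc ε Rm s`, `Ex = ExchangeUnstable ε s 1`; `ε > 0`, `1 + s ≤ Rm ≤ ϱ`).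
[folklore chaining] -/
theorem aperiodicFrustratedLawGap_of_schurMotifsX_move_fourHalf {κT CT DT κE CE DE DX D ϱ R' ρ B R'' ρ' B' ε Rm s : ℝ}
    {FT FE : TransferRule}
    (hDoor : Summit.AtomisticToContinuum.Crystallization.Theses.GrainCoreNetworkSplit.MuEquilibriumDoor)
    (hF : SF₄₅) (hU : PeriodicEnergyCeiling (-(7175 / 10000))) (hε : 0 < ε) (hRm1 : 1 + s ≤ Rm) (hRm : Rm ≤ ϱ)
    (hT₁ : HasRange R' FT) (hT₂ : IsLocal ρ FT) (hT₃ : IsBounded B FT)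
    (hE₁ : HasRange R'' FE) (hE₂ : IsLocal ρ' FE) (hE₃ : IsBounded B' FE)
    (hR : 9 / 2 ≤ ϱ) (hRρ : R' + ρ ≤ ϱ) (hρ : ρ ≤ ϱ) (hR' : R' ≤ ϱ) (hRρ' : R'' + ρ' ≤ ϱ) (hρ'' : ρ' ≤ ϱ) (hR'' : R'' ≤ ϱ)
    (hD : 13 / 10 * D + 1 ≤ ϱ)
    (hκT : 0 < κT) (hCT : 0 ≤ CT) (hDT : 0 ≤ DT) (hκE : 0 < κE) (hCE : 0 ≤ κE + CE) (hDE : 0 ≤ κE + DE) (hDX : 0 ≤ DX)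
    (hT : PairRuleMotifCertificateX (1 / 20) (1 / 8) (effPot w₄₅ ω₄ (3 / 400)) (3 / 400) (-(7175 / 10000) + κT) (-CT) (-κT) (-DT)
      D ϱ FT (MoveUnstableLoc ε Rm s))
    (hEc : PairRuleMotifCertificateXE (1 / 20) (1 / 8) (effPot w₄₅ ω₄ (3 / 400)) (3 / 400) (-(7175 / 10000) - DE) (-(κE + CE)) (κE + DE)
      (-DX) D ϱ FE (MoveUnstableLoc ε Rm s)) :
    Summit.AtomisticToContinuum.Crystallization.Theses.FrustratedLawDichotomy.AperiodicFrustratedLawGap :=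
  aperiodicFrustratedLawGap_of_schurMotifsX_fourHalf hDoor hF hU (deepAbsent_exchangeUnstable (ϱ := s) (K := 1) hε)
    (motifTransfer_exchangeUnstable_of_move hRm1 hRm) hT₁ hT₂ hT₃ hE₁ hE₂ hE₃ hR hRρ hρ hR' hRρ' hρ'' hR'' hD hκT hCT hDT hκE hCE hDE hDX hT hEc

/-- ★★ **Instance: the LOCAL EXCHANGE exemption column at sharp slack** (`ExM = ExchangeUnstableLoc (ε + 2K·T♯(Dfar)) ϱ′ Rm K`, `Ex = ExchangeUnstable ε ϱ′ K`;
`ε > 0`, `ϱ′ + Dfar ≤ Rm ≤ ϱ`, `Dfar ≥ 1`). [folklore chaining] -/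
theorem aperiodicFrustratedLawGap_of_schurMotifsX_exchangeLoc_fourHalf {κT CT DT κE CE DE DX D ϱ R' ρ B R'' ρ' B' ε ϱ' Rm Dfar : ℝ} {K : ℕ}
    {FT FE : TransferRule}
    (hDoor : Summit.AtomisticToContinuum.Crystallization.Theses.GrainCoreNetworkSplit.MuEquilibriumDoor)
    (hF : SF₄₅) (hU : PeriodicEnergyCeiling (-(7175 / 10000))) (hε : 0 < ε) (hRmD : ϱ' + Dfar ≤ Rm) (hDfar : (1 : ℝ) ≤ Dfar)
    (hRm : Rm ≤ ϱ)
    (hT₁ : HasRange R' FT) (hT₂ : IsLocal ρ FT) (hT₃ : IsBounded B FT)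
    (hE₁ : HasRange R'' FE) (hE₂ : IsLocal ρ' FE) (hE₃ : IsBounded B' FE)
    (hR : 9 / 2 ≤ ϱ) (hRρ : R' + ρ ≤ ϱ) (hρ : ρ ≤ ϱ) (hR' : R' ≤ ϱ) (hRρ' : R'' + ρ' ≤ ϱ) (hρ'' : ρ' ≤ ϱ) (hR'' : R'' ≤ ϱ)
    (hD : 13 / 10 * D + 1 ≤ ϱ)
    (hκT : 0 < κT) (hCT : 0 ≤ CT) (hDT : 0 ≤ DT) (hκE : 0 < κE) (hCE : 0 ≤ κE + CE) (hDE : 0 ≤ κE + DE) (hDX : 0 ≤ DX)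
    (hT : PairRuleMotifCertificateX (1 / 20) (1 / 8) (effPot w₄₅ ω₄ (3 / 400)) (3 / 400) (-(7175 / 10000) + κT) (-CT) (-κT) (-DT)
      D ϱ FT (ExchangeUnstableLoc (ε + 2 * K * tailConstSharp Dfar) ϱ' Rm K))
    (hEc : PairRuleMotifCertificateXE (1 / 20) (1 / 8) (effPot w₄₅ ω₄ (3 / 400)) (3 / 400) (-(7175 / 10000) - DE) (-(κE + CE)) (κE + DE)
      (-DX) D ϱ FE (ExchangeUnstableLoc (ε + 2 * K * tailConstSharp Dfar) ϱ' Rm K)) :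
    Summit.AtomisticToContinuum.Crystallization.Theses.FrustratedLawDichotomy.AperiodicFrustratedLawGap :=
  aperiodicFrustratedLawGap_of_schurMotifsX_fourHalf hDoor hF hU (deepAbsent_exchangeUnstable (ϱ := ϱ') (K := K) hε)
    (motifTransfer_exchangeUnstable_sharp hRmD hDfar hRm) hT₁ hT₂ hT₃ hE₁ hE₂ hE₃ hR hRρ hρ hR' hRρ' hρ'' hR'' hD hκT hCT hDT hκE hCE hDE
    hDX hT hEc

end Summit.AtomisticToContinuum.Crystallization.Theorems.FrustratedLawDichotomyPairPotentialDoorXE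

end
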